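import Summits.MatrixMultiplication.MatrixMultiplication.Theses.CubicExchangeSplit
import Literature.Computability.AlgebraicComplexity.RectangularExponentAsymptoticRank
import Literature.Computability.AlgebraicComplexity.AsymptoticSpectrumDuality

/-!
# Crux `CubicExchange` (SUBMOD₃) of route `CubicExchangeSplit` — birth skeleton, line `birth` (CoMax)

Crux (item stmt-MatrixMultiplication-18001, rank 3, fixed):
`CubicExchange` = for all real `β, β'` with `R⟨n³,n,n⟩ = O(n^β)`, `R⟨n,n³,n⟩ = O(n^{β'})` and every
`ε > 0` there are `γ, γ'` with `γ + γ' ≤ β + β' + ε`, `R⟨n³,n³,n⟩ = O(n^γ)`, `R⟨n,n,n⟩ = O(n^{γ'})`;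
in exponent form `ω(3,3,1) + ω(1,1,1) ≤ ω(3,1,1) + ω(1,3,1)` (the lattice exchange law at the pair
`(3,1,1) & (1,3,1)`, join `(3,3,1)`, meet `(1,1,1)`).

## The line (CoMax = one common maximiser in the asymptotic spectrum)

By the tree's dictionary `R̃(⟨2^a,2^b,2^c⟩) = 2^{ω(a,b,c)}`
(`asymptoticRank_matMulTensor_rect`, ADVXXZ 2025 §3.4, proved) the exponent form reads
`R̃⟨8,8,2⟩ · R̃⟨2,2,2⟩ ≤ R̃⟨8,2,2⟩ · R̃⟨2,8,2⟩`.  Strassen duality (`strassen_duality_asymptoticRank_holds`,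
CVZ 2023 Prop. 1.6, proved in tree) writes each `R̃(t) = max_{F ∈ Δ} F(t)`.  For ONE universal
spectral point `F`, multiplicativity and `⟨8,8,2⟩ ⊗ ⟨2,2,2⟩ ≅ ⟨16,16,4⟩ ≅ ⟨8,2,2⟩ ⊗ ⟨2,8,2⟩`
(`kroneckerTensor_matMulTensor`) give the *pointwise exchange identity*
`F⟨8,8,2⟩ · F⟨2,2,2⟩ = F⟨16,16,4⟩ = F⟨8,2,2⟩ · F⟨2,8,2⟩ ≤ R̃⟨8,2,2⟩ · R̃⟨2,8,2⟩`.
Hence the crux follows as soon as a SINGLE spectral point maximises `⟨8,8,2⟩` and `⟨2,2,2⟩`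
simultaneously — `stub_coMax`, the lever (open; implied by `ω = 2`, where the gauge point `ζ⁽²⁾`
is such a common maximiser: `ζ⁽²⁾⟨2,2,2⟩ = 4 = 2^ω`, `ζ⁽²⁾⟨8,8,2⟩ = 64 = 2^{ω(3,3,1)}`).
Equivalently (duality on the single tensor `⟨16,16,4⟩`): CoMax ⟺ `R̃` is multiplicative on the pair
`⟨8,8,2⟩, ⟨2,2,2⟩` ⟺ `ω(3,3,1) + ω = 2·ω(2,2,1)` (midpoint affinity of `a ↦ ω(a,a,1)` on `[1,3]`),
which is STRONGER than the crux by the proved amount `2(ω(1,1,3) − ω(2,2,1)) ≥ 0`.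

The second stub `stub_rankForm` is the transfer (dictionary) `C ↔ C⁺` between the route's two-β rank
form and the exponent form over the tree's `omegaRect` (provable now: `rectDim n 3 = n^3`, infimum
bookkeeping, upward closure and lower-boundedness of admissible exponents; difficulty M).

The composition is PROVED here (no sorry): `exponentExchange_of_coMax : CoMax → exponent form`
(Kronecker exchange for spectral points + duality part 1 + the `R̃ = 2^{ω(·)}` dictionary +
monotonicity of `2^x`), and the registrar theorem
`CubicExchange_of : CubicExchange := stub_rankForm.2 (exponentExchange_of_coMax stub_coMax)` concludes
the crux BY NAME with `sorry` only inside the two declared stubs.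

Disproof used: none relevant (no `Disproof.lean` / Negative lemma is filed on this crux at birth;
`ledger crux ls` shows no workfiles).  Dead lines: none recorded for this crux.
-/

namespace Summit.MatrixMultiplication.MatrixMultiplication.Cruxes.CubicExchange.Birth

/-- **stub_coMax** (the lever; OPEN, the hard stub). *CoMax*: one universal spectral point of
3-tensors over `ℂ` attains the asymptotic rank at BOTH `⟨8,8,2⟩` and `⟨2,2,2⟩` (each maximum is
attained separately by Strassen duality, `strassen_duality_asymptoticRank_holds`; the claim is a
COMMON maximiser).  Equivalent to `R̃⟨16,16,4⟩ = R̃⟨8,8,2⟩ · R̃⟨2,2,2⟩`, i.e. to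
`ω(3,3,1) + ω = 2·ω(2,2,1)`; implied by `ω = 2` (gauge point `ζ⁽²⁾`).  Why plausibly true: every
known explicit spectral point (gauge / support / quantum functionals) is simultaneously extremal on
all matrix multiplication formats; the bet is that a maximiser of `⟨2,2,2⟩` can be chosen extremal
on the flattening-tight format `⟨8,8,2⟩` too.  Size: L (open).
[sources: Strassen1988 Thm 3.8; ChristandlVranaZuiddam2023 Prop 1.6, Ex 1.4; LottiRomani1983] -/
theorem stub_coMax :
    ∃ F : Literature.Computability.AlgebraicComplexity.SpectralMap ℂ,
      Literature.Computability.AlgebraicComplexity.IsUniversalSpectralPoint ℂ F ∧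
      F (Literature.Computability.AlgebraicComplexity.matMulTensor ℂ 8 8 2) =
        Literature.Computability.AlgebraicComplexity.asymptoticRank
          (Literature.Computability.AlgebraicComplexity.matMulTensor ℂ 8 8 2) ∧
      F (Literature.Computability.AlgebraicComplexity.matMulTensor ℂ 2 2 2) =
        Literature.Computability.AlgebraicComplexity.asymptoticRank
          (Literature.Computability.AlgebraicComplexity.matMulTensor ℂ 2 2 2) := by
  sorry

/-- **stub_rankForm** (transfer `C ↔ C⁺`, the dictionary; provable now, difficulty M). The route's
two-β rank form `CubicExchange` is EQUIVALENT to the exponent form of the cubic exchange over the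
tree's rank-form rectangular exponents (`omegaRect ℂ a b c = inf {β | R⟨⌈n^a⌉,⌈n^b⌉,⌈n^c⌉⟩ = O(n^β)}`,
Le Gall's rank form): `ω(3,3,1) + ω(1,1,1) ≤ ω(3,1,1) + ω(1,3,1)`.
`←` (the load-bearing direction): given admissible `β` for `⟨n³,n,n⟩` and `β'` for `⟨n,n³,n⟩`
(`rectDim n 3 = n^3`, `rectDim n 1 = n`, so `ω(3,1,1) ≤ β`, `ω(1,3,1) ≤ β'` by `csInf_le`; the sets are
bounded below by `0` since the ranks are `≥ 1`) and `ε > 0`, take `γ = ω(3,3,1) + ε/2`,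
`γ' = ω(1,1,1) + ε/2`, admissible by `exists_lt_of_csInf_lt` + upward closure
(`mem_rectAdmissibleExponents_of_le`), with `γ + γ' ≤ β + β' + ε`.  `→`: feed `β = ω(3,1,1) + δ`,
`β' = ω(1,3,1) + δ` (admissible), get admissible `γ, γ'` for join/meet with `γ + γ' ≤ β + β' + δ`, so
`ω(3,3,1) + ω(1,1,1) ≤ γ + γ' ≤ ω(3,1,1) + ω(1,3,1) + 3δ` for every `δ > 0`.  Pure dictionary; no
exponent mathematics (cf. the refuter's `cubicExchange_iff_oneBeta`, evidence Vetting.lean).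
[sources: LeGall2012 §2; Blaser2013 Def 5.1; LottiRomani1983] -/
theorem stub_rankForm :
    Summit.MatrixMultiplication.MatrixMultiplication.Theses.CubicExchangeSplit.CubicExchange ↔
      Literature.Computability.AlgebraicComplexity.omegaRect ℂ 3 3 1 +
          Literature.Computability.AlgebraicComplexity.omegaRect ℂ 1 1 1 ≤
        Literature.Computability.AlgebraicComplexity.omegaRect ℂ 3 1 1 +
          Literature.Computability.AlgebraicComplexity.omegaRect ℂ 1 3 1 := by
  sorry

open Literature.Computability.AlgebraicComplexity in
/-- **The content of the line (PROVED): CoMax ⟹ the exponent form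
`ω(3,3,1) + ω(1,1,1) ≤ ω(3,1,1) + ω(1,3,1)`.**  A common maximiser `F` gives
`R̃⟨8,8,2⟩ · R̃⟨2,2,2⟩ = F⟨8,8,2⟩ · F⟨2,2,2⟩ = F(⟨8,8,2⟩ ⊗ ⟨2,2,2⟩) = F⟨16,16,4⟩
= F(⟨8,2,2⟩ ⊗ ⟨2,8,2⟩) = F⟨8,2,2⟩ · F⟨2,8,2⟩ ≤ R̃⟨8,2,2⟩ · R̃⟨2,8,2⟩` (multiplicativity, invariance
under relabelling, duality part 1); with `R̃⟨2^a,2^b,2^c⟩ = 2^{ω(a,b,c)}` this is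
`2^{ω(3,3,1)+ω(1,1,1)} ≤ 2^{ω(3,1,1)+ω(1,3,1)}`; take `log₂`. [folklore assembly over tree theorems] -/
theorem exponentExchange_of_coMax
    (hCoMax : ∃ F : SpectralMap ℂ, IsUniversalSpectralPoint ℂ F ∧
      F (matMulTensor ℂ 8 8 2) = asymptoticRank (matMulTensor ℂ 8 8 2) ∧
      F (matMulTensor ℂ 2 2 2) = asymptoticRank (matMulTensor ℂ 2 2 2)) :
    omegaRect ℂ 3 3 1 + omegaRect ℂ 1 1 1 ≤ omegaRect ℂ 3 1 1 + omegaRect ℂ 1 3 1 := by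
  obtain ⟨F, hF, h882, h222⟩ := hCoMax
  -- (1) a spectral point takes the same value on `⟨k,m,n⟩ ⊗ ⟨k',m',n'⟩` and `⟨kk',mm',nn'⟩`
  --     (the Kronecker product IS the big matrix tensor up to relabelling the indices)
  have kron_eq : ∀ k m n k' m' n' : ℕ,
      F (kroneckerTensor (matMulTensor ℂ k m n) (matMulTensor ℂ k' m' n')) =
        F (matMulTensor ℂ (k * k') (m * m') (n * n')) := by
    intro k m n k' m' n'
    have hfun : kroneckerTensor (matMulTensor ℂ k m n) (matMulTensor ℂ k' m' n') =
        fun a b c => matMulTensor ℂ (k * k') (m * m') (n * n') (doubleIndexEquiv k n k' n' a)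
          (doubleIndexEquiv k m k' m' b) (doubleIndexEquiv m n m' n' c) := by
      funext a b c
      exact kroneckerTensor_matMulTensor ℂ k m n k' m' n' a b c
    rw [hfun]
    classical
    exact hF.eq_of_restrictsTo
      (tensorRestrictsTo_precomp (matMulTensor ℂ (k * k') (m * m') (n * n'))
        (doubleIndexEquiv k n k' n') (doubleIndexEquiv k m k' m') (doubleIndexEquiv m n m' n'))
      (tensorRestrictsTo_of_reindex (matMulTensor ℂ (k * k') (m * m') (n * n'))
        (doubleIndexEquiv k n k' n') (doubleIndexEquiv k m k' m') (doubleIndexEquiv m n m' n'))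
  -- (2) the pointwise exchange identity `F⟨8,8,2⟩·F⟨2,2,2⟩ = F⟨16,16,4⟩ = F⟨8,2,2⟩·F⟨2,8,2⟩`
  have x1 : F (matMulTensor ℂ 8 8 2) * F (matMulTensor ℂ 2 2 2) = F (matMulTensor ℂ 16 16 4) :=
    (hF.map_kronecker _ _).symm.trans (kron_eq 8 8 2 2 2 2)
  have x2 : F (matMulTensor ℂ 8 2 2) * F (matMulTensor ℂ 2 8 2) = F (matMulTensor ℂ 16 16 4) :=
    (hF.map_kronecker _ _).symm.trans (kron_eq 8 2 2 2 8 2)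
  -- (3) duality, part 1: every spectral point is below the asymptotic rank
  have d822 : F (matMulTensor ℂ 8 2 2) ≤ asymptoticRank (matMulTensor ℂ 8 2 2) :=
    (strassen_duality_asymptoticRank_holds ℂ (matMulTensor ℂ 8 2 2)).1 F hF
  have d282 : F (matMulTensor ℂ 2 8 2) ≤ asymptoticRank (matMulTensor ℂ 2 8 2) :=
    (strassen_duality_asymptoticRank_holds ℂ (matMulTensor ℂ 2 8 2)).1 F hF
  have hprod : asymptoticRank (matMulTensor ℂ 8 8 2) * asymptoticRank (matMulTensor ℂ 2 2 2) ≤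
      asymptoticRank (matMulTensor ℂ 8 2 2) * asymptoticRank (matMulTensor ℂ 2 8 2) := by
    rw [← h882, ← h222, x1, ← x2]
    exact mul_le_mul d822 d282 (hF.nonneg _) (asymptoticRank_nonneg _)
  -- (4) the dictionary `R̃⟨2^a,2^b,2^c⟩ = 2^{ω(a,b,c)}` (ADVXXZ 2025 §3.4, tree)
  have rect : ∀ a b c : ℕ, asymptoticRank (matMulTensor ℂ (2 ^ a) (2 ^ b) (2 ^ c)) =
      (2 : ℝ) ^ omegaRect ℂ (a : ℝ) (b : ℝ) (c : ℝ) := by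
    intro a b c
    have h := asymptoticRank_matMulTensor_rect ℂ (show (2 : ℕ) ≤ 2 from le_rfl) a b c
    exact_mod_cast h
  have r882 : asymptoticRank (matMulTensor ℂ 8 8 2) = (2 : ℝ) ^ omegaRect ℂ 3 3 1 := by
    have h : asymptoticRank (matMulTensor ℂ 8 8 2) =
        (2 : ℝ) ^ omegaRect ℂ ((3 : ℕ) : ℝ) ((3 : ℕ) : ℝ) ((1 : ℕ) : ℝ) := rect 3 3 1
    rw [h]; norm_num
  have r222 : asymptoticRank (matMulTensor ℂ 2 2 2) = (2 : ℝ) ^ omegaRect ℂ 1 1 1 := by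
    have h : asymptoticRank (matMulTensor ℂ 2 2 2) =
        (2 : ℝ) ^ omegaRect ℂ ((1 : ℕ) : ℝ) ((1 : ℕ) : ℝ) ((1 : ℕ) : ℝ) := rect 1 1 1
    rw [h]; norm_num
  have r822 : asymptoticRank (matMulTensor ℂ 8 2 2) = (2 : ℝ) ^ omegaRect ℂ 3 1 1 := by
    have h : asymptoticRank (matMulTensor ℂ 8 2 2) =
        (2 : ℝ) ^ omegaRect ℂ ((3 : ℕ) : ℝ) ((1 : ℕ) : ℝ) ((1 : ℕ) : ℝ) := rect 3 1 1
    rw [h]; norm_num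
  have r282 : asymptoticRank (matMulTensor ℂ 2 8 2) = (2 : ℝ) ^ omegaRect ℂ 1 3 1 := by
    have h : asymptoticRank (matMulTensor ℂ 2 8 2) =
        (2 : ℝ) ^ omegaRect ℂ ((1 : ℕ) : ℝ) ((3 : ℕ) : ℝ) ((1 : ℕ) : ℝ) := rect 1 3 1
    rw [h]; norm_num
  -- (5) `2^{ω(3,3,1)+ω(1,1,1)} ≤ 2^{ω(3,1,1)+ω(1,3,1)}`, then take `log₂`
  have key : (2 : ℝ) ^ (omegaRect ℂ 3 3 1 + omegaRect ℂ 1 1 1) ≤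
      (2 : ℝ) ^ (omegaRect ℂ 3 1 1 + omegaRect ℂ 1 3 1) := by
    rw [Real.rpow_add two_pos, Real.rpow_add two_pos]
    calc (2 : ℝ) ^ omegaRect ℂ 3 3 1 * (2 : ℝ) ^ omegaRect ℂ 1 1 1
        = asymptoticRank (matMulTensor ℂ 8 8 2) * asymptoticRank (matMulTensor ℂ 2 2 2) := by
          rw [r882, r222]
      _ ≤ asymptoticRank (matMulTensor ℂ 8 2 2) * asymptoticRank (matMulTensor ℂ 2 8 2) := hprod
      _ = (2 : ℝ) ^ omegaRect ℂ 3 1 1 * (2 : ℝ) ^ omegaRect ℂ 1 3 1 := by rw [r822, r282]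
  exact (Real.rpow_le_rpow_left_iff one_lt_two).1 key

/-- **THE SKELETON THEOREM (registrar shape): `stub_coMax → stub_rankForm → CubicExchange`.**  The crux
`Summit.MatrixMultiplication.MatrixMultiplication.Theses.CubicExchangeSplit.CubicExchange`, concluded
BY NAME from the two declared stubs through the sorry-free `exponentExchange_of_coMax`; the only
`sorry`s in its closure are `stub_coMax` and `stub_rankForm`. [folklore assembly] -/
theorem CubicExchange_of :
    Summit.MatrixMultiplication.MatrixMultiplication.Theses.CubicExchangeSplit.CubicExchange :=
  stub_rankForm.2 (exponentExchange_of_coMax stub_coMax)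

end Summit.MatrixMultiplication.MatrixMultiplication.Cruxes.CubicExchange.Birth
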